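import Summits.QuantumFields.BalabanUV.Beta.FP.ExpLocalisedBubble
import Summits.QuantumFields.BalabanUV.Beta.FP.LegPairingBounds
import Summits.QuantumFields.BalabanUV.Beta.FP.DecimationSecondMoment

/-!
# `BalabanUV.Beta.FP.FarRegionSmear` — road «FP» (binder row D1), `RHOA-DESIGN.md` §3 (F-PC) ∕ §5 row RHOA-4 «FAR-REGION MOMENT», PART 2a (towards (b)):
# THE TRUNCATED SMEARING ENGINE AT A FAR POINT — an exponentially localised two-point weight sees only the OUTER half `‖t‖∞ ≥ ‖z‖∞/2` of the kernel up to
# `sup|H|·C·e^{−(δ/4)‖z‖∞}·Zl(δ/2)²`, so `ExpLocalisedBubble.abs_smear_sub_order1_le` may be fed with the kernel's OUTER (graded, scale-`n`) constants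
# ([folklore] lattice bookkeeping on `ℤ⁴`; G-an2-4 formalisation swarm, unit `b2b-balaban-gan24-formalise-leaf-06`, gen 32, cross-lane idle-seat brick)

HONEST DEPENDENCY (page 1, mandatory): continuum YM on T⁴ ⇐ BetaPertH ∧ nine spine estimates (0/9 proved); BetaPertH ⇐ (D1) ∧ (D4) ∧
CAP+tail; G-an2-4 gates asym, D1 and NE2/3/4.  HONEST FRAMING (cell contract, verbatim): «discharging `BetaPertH` makes Bałaban's UV
stability UNCONDITIONAL — a real constructive-QFT result; it is NOT the continuum limit and NOT the Clay problem.»  THIS MODULE is elementary [folklore]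
real analysis on `ℤ⁴` over leaf-02-g6's H2-a engine `FP/ExpLocalisedBubble` BY NAME (`abs_smear_sub_order1_le`, `summable_smear`, the letters `Θ_m`); the far shape it
feeds is gen-32's `FP/FarRegionMoment` (via the sequel `FP/FarRegionSmearGraded`); it asserts nothing about Bałaban's objects, cites nothing, mints no `Prop` fact, has no `def`,
0 sorry.  The graded data of the legs of the H′ route (IR-5∕IR-6, H2-ASM-2) and the vertex weights (H2V) are HYPOTHESES displayed in the signatures.  NOT `hbook`, NOT
`ρ_n = O(1)`, NOT D1, NOT BetaPertH, NOT continuum, NOT Clay; «not in print; our bookkeeping».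

WHY (RHOA-DESIGN §3 ORGANISATION β, (F-PC) «FAR `‖z‖ > n`: … ⟸ graded legs + vertex locality»): the H2-a engine bounds the Taylor remainder of a smeared kernel
by its GLOBAL sup `A₀` in the far term `2A₀·Θ_k/ρ^k` — a power of `‖z‖` only; for the scale-`n` exponential of the F-PC shape one needs the OUTER sup instead.  Since the
engine's hypotheses are a global bound, the first differences AT `z` and the second differences ON THE BOX of radius `ρ = ⌊‖z‖∞/4⌋` around `z`, they are all met by the
OUTER TRUNCATION `Ho := H·𝟙[‖·‖∞ ≥ ‖z‖∞/2]` with the outer constants (`‖z‖∞ ≥ 8`), and the inner complement `H − Ho` is seen by the weight only through pairs with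
`|x|₁ + |y|₁ > (‖z‖∞−1)/2`, i.e. at the cost `sup|H|·C·e^{−(δ/2)(‖z‖∞−1)/2}·Zl(δ/2)²` — exponentially small at the weight's OWN (n-free) scale.
CONTENT.
* §1 (general `D`) `hasSum_prod_exp` (`Σ'_{x,y} e^{−a|x|₁}e^{−a|y|₁} = Zl(a)²`), **`abs_smear_le_of_vanish_near`**: `|G| ≤ Ag`, `G(z+s) = 0` for `|s|₁ ≤ R`
  ⟹ `|Σ' c·G(z+x−y)| ≤ Ag·C·e^{−(δ/2)R}·Zl(δ/2)²`.
* §2 (`ℤ⁴`, sup-norm; `supNorm_le_l1` ∕ `supNorm_le_supNorm_add_single` are `LegPairingBounds` ∕ `DecimationSecondMoment`'s BY NAME) `supNorm_le_supNorm_add_add`, `abs_outer_le`,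
  `inner_vanish`, `outer_of_mem_box` (box geometry at `‖z‖∞ ≥ 8`), **`abs_smear_sub_order1_le_far`**: `|Σ' c·H(z+x−y) − (Σ'c)·H z − Σ_i m_i·Δ_iH z| ≤ C·(4·5·b·Θ₂ + (2a₀·Θ_k + a₁·Θ_{k+1})/ρ^k) + Ag·C·e^{−(δ/2)(‖z‖∞−1)/2}·Zl(δ/2)²`
  with OUTER data `a₀` (sup of `|H|` on `‖t‖∞ ≥ ‖z‖∞/2`), `a₁` (first differences at `z`), `b` (second differences on the box) — `ExpLocalisedBubble.abs_smear_sub_order1_le` BY NAME on `Ho`.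
The graded corollary (scale-`n` graded data ⟹ the far shape of `FP/FarRegionMoment` with `b = 2`) is the sequel `FP/FarRegionSmearGraded`.
Provenance: leaf prover 06 (gen 32), 2026-08-20; no existing file touched.
-/

noncomputable section

namespace Summit.QuantumFields.BalabanUV.Beta.FP.FarRegionSmear

open Finset Filter Topology fwdDiff
open scoped BigOperators
open Literature.MathematicalPhysics.QuantumFieldTheory.Balaban1983to89
open Literature.MathematicalPhysics.QuantumFieldTheory.Balaban1983to89.Beta
open B12Sec2to5 (l1 l1_nonneg abs_coord_le_l1)
open ExpKernelCalculus (Site Zl Zl_pos l1_sub_triangle l1_sub_symm summable_exp_shift' tsum_exp_shift')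
open DyadicShell (Pt supNorm natAbs_le_supNorm supNorm_le_iff exists_eq_supNorm)
open Summit.QuantumFields.BalabanUV.Beta.FP.HorizontalBookkeepingTail (supNorm_le_add_of_box l1_eq_natCast)
open Summit.QuantumFields.BalabanUV.Beta.FP.ExpLocalisedBubble
open Summit.QuantumFields.BalabanUV.Beta.FP.LegPairingBounds (supNorm_le_l1)
open Summit.QuantumFields.BalabanUV.Beta.FP.DecimationSecondMoment (supNorm_le_supNorm_add_single)

/-! ## §1 The complement piece: a weight localised at the origin pair does not see a kernel vanishing on the `ℓ¹`-ball of radius `R` around the base point,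
up to `e^{−(δ/2)R}` -/

section Complement

variable {D : ℕ} {c : Site D × Site D → ℝ} {G : Site D → ℝ} {C δ Ag : ℝ}

/-- [folklore] The product exponential weight on `ℤ^D × ℤ^D` has sum `Zl(a)²`. -/
theorem hasSum_prod_exp {a : ℝ} (ha : 0 < a) :
    HasSum (fun p : Site D × Site D => Real.exp (-a * l1 p.1) * Real.exp (-a * l1 p.2)) (Zl D a ^ 2) := by
  have hs : Summable fun x : Site D => Real.exp (-a * l1 x) := by
    simpa using summable_exp_shift' (D := D) ha 0
  have ht : ∑' x : Site D, Real.exp (-a * l1 x) = Zl D a := by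
    simpa using tsum_exp_shift' (D := D) (c := a) 0
  have hnn : 0 ≤ fun x : Site D => Real.exp (-a * l1 x) := fun x => (Real.exp_pos _).le
  have H := (hs.hasSum.mul hs.hasSum) (hs.mul_of_nonneg hs hnn hnn)
  rw [ht, ← sq] at H
  exact H

/-- [folklore] **THE COMPLEMENT PIECE.**  If `|c(x,y)| ≤ C·e^{−δ(|x|₁+|y|₁)}`, `|G| ≤ Ag`, and `G(z+s) = 0` whenever `|s|₁ ≤ R`, then
`|Σ'_{x,y} c(x,y)·G(z+x−y)| ≤ Ag·C·e^{−(δ/2)R}·Zl(δ/2)²` (only pairs with `|x|₁+|y|₁ ≥ |x−y|₁ > R` contribute). -/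
theorem abs_smear_le_of_vanish_near (hδ : 0 < δ) (hc : ∀ p : Site D × Site D, |c p| ≤ C * (Real.exp (-δ * l1 p.1) * Real.exp (-δ * l1 p.2)))
    (hG : ∀ t, |G t| ≤ Ag) (z : Site D) {R : ℝ} (hvan : ∀ s : Site D, l1 s ≤ R → G (z + s) = 0) :
    |∑' p : Site D × Site D, c p * G (z + p.1 - p.2)| ≤ Ag * C * Real.exp (-(δ / 2) * R) * Zl D (δ / 2) ^ 2 := by
  have hC := nonneg_of_loc hc
  have hAg : 0 ≤ Ag := (abs_nonneg _).trans (hG z)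
  have HM := (hasSum_prod_exp (D := D) (half_pos hδ)).mul_left (Ag * C * Real.exp (-(δ / 2) * R))
  have hb := tsum_of_norm_bounded HM (f := fun p : Site D × Site D => c p * G (z + p.1 - p.2)) (fun p => ?_)
  · rw [Real.norm_eq_abs] at hb
    refine hb.trans (le_of_eq ?_)
    ring
  rw [Real.norm_eq_abs, abs_mul]
  by_cases hR : l1 (p.1 - p.2) ≤ R
  · rw [show z + p.1 - p.2 = z + (p.1 - p.2) from add_sub_assoc z p.1 p.2, hvan _ hR, abs_zero, mul_zero]
    have := Real.exp_pos (-(δ / 2) * R); have := Real.exp_pos (-(δ / 2) * l1 p.1); have := Real.exp_pos (-(δ / 2) * l1 p.2)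
    positivity
  · push Not at hR
    have hle : l1 (p.1 - p.2) ≤ l1 p.1 + l1 p.2 := by
      have t := l1_sub_triangle p.1 0 p.2
      rwa [sub_zero, l1_sub_symm 0 p.2, sub_zero] at t
    have hsum : R < l1 p.1 + l1 p.2 := hR.trans_le hle
    have hexp : Real.exp (-δ * l1 p.1) * Real.exp (-δ * l1 p.2)
        ≤ Real.exp (-(δ / 2) * R) * (Real.exp (-(δ / 2) * l1 p.1) * Real.exp (-(δ / 2) * l1 p.2)) := by
      rw [← Real.exp_add, ← Real.exp_add, ← Real.exp_add]
      exact Real.exp_le_exp.mpr (by nlinarith [l1_nonneg p.1, l1_nonneg p.2])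
    calc |c p| * |G (z + p.1 - p.2)| ≤ C * (Real.exp (-δ * l1 p.1) * Real.exp (-δ * l1 p.2)) * Ag :=
          mul_le_mul (hc p) (hG _) (abs_nonneg _) (by positivity)
      _ ≤ C * (Real.exp (-(δ / 2) * R) * (Real.exp (-(δ / 2) * l1 p.1) * Real.exp (-(δ / 2) * l1 p.2))) * Ag :=
          mul_le_mul_of_nonneg_right (mul_le_mul_of_nonneg_left hexp hC) hAg
      _ = Ag * C * Real.exp (-(δ / 2) * R) * (Real.exp (-(δ / 2) * l1 p.1) * Real.exp (-(δ / 2) * l1 p.2)) := by ring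

end Complement

/-! ## §2 The truncated engine at a far point of `ℤ⁴`: `ExpLocalisedBubble.abs_smear_sub_order1_le` fed with the OUTER constants of the kernel -/

section Far

variable {c : Pt × Pt → ℝ} {H : Pt → ℝ} {C δ Ag : ℝ}

/-- [folklore] `‖z‖∞ ≤ ‖z + s‖∞ + ‖s‖∞`. -/
theorem supNorm_le_supNorm_add_add (z s : Pt) : supNorm z ≤ supNorm (z + s) + supNorm s :=
  supNorm_le_add_of_box (t := z + s) (y := z) fun i => by
    rw [show (z + s) i - z i = s i by simp, Int.abs_eq_natAbs]
    exact_mod_cast natAbs_le_supNorm s i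

/-- The OUTER TRUNCATION of `H` at level `‖z‖∞/2`: `Ho t := H t` if `‖z‖∞ ≤ 2‖t‖∞`, else `0`. [folklore] -/
theorem outer_apply_of_le {z t : Pt} (h : supNorm z ≤ 2 * supNorm t) (H : Pt → ℝ) :
    (if supNorm z ≤ 2 * supNorm t then H t else 0) = H t := if_pos h

/-- [folklore] The outer truncation is bounded by the outer constant `a₀` everywhere. -/
theorem abs_outer_le {z : Pt} {a₀ : ℝ} (hout0 : ∀ t : Pt, supNorm z ≤ 2 * supNorm t → |H t| ≤ a₀) (t : Pt) :
    |(if supNorm z ≤ 2 * supNorm t then H t else 0)| ≤ a₀ := by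
  have ha0 : 0 ≤ a₀ := (abs_nonneg _).trans (hout0 z (by omega))
  by_cases h : supNorm z ≤ 2 * supNorm t
  · rw [if_pos h]; exact hout0 t h
  · rw [if_neg h, abs_zero]; exact ha0

/-- [folklore] The complement `H − Ho` is bounded by the global constant and VANISHES at `z + s` for `|s|₁ ≤ (‖z‖∞ − 1)/2`. -/
theorem inner_vanish {z : Pt} (s : Pt) (hs : l1 s ≤ ((supNorm z : ℝ) - 1) / 2) :
    H (z + s) - (if supNorm z ≤ 2 * supNorm (z + s) then H (z + s) else 0) = 0 := by
  have h1 : (supNorm s : ℝ) ≤ ((supNorm z : ℝ) - 1) / 2 := (supNorm_le_l1 s).trans hs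
  have h2 : 2 * supNorm s + 1 ≤ supNorm z := by
    have : (2 : ℝ) * supNorm s + 1 ≤ supNorm z := by linarith
    exact_mod_cast this
  have h3 := supNorm_le_supNorm_add_add z s
  rw [if_pos (by omega), sub_self]

/-- [folklore] On the coordinate box of radius `⌊‖z‖∞/4⌋` around `z` (`‖z‖∞ ≥ 8`), a point and its unit translates are OUTER. -/
theorem outer_of_mem_box {z t : Pt} (hz : 8 ≤ supNorm z) (ht : ∀ i, |t i - z i| ≤ ((supNorm z / 4 : ℕ) : ℤ)) :
    supNorm z ≤ 2 * supNorm t ∧ (∀ i, supNorm z ≤ 2 * supNorm (t + Pi.single i 1)) ∧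
      ∀ i j, supNorm z ≤ 2 * supNorm (t + Pi.single i 1 + Pi.single j 1) := by
  have hbox := supNorm_le_add_of_box ht
  have hρ : 4 * (supNorm z / 4) ≤ supNorm z := Nat.mul_div_le _ _
  refine ⟨by omega, fun i => ?_, fun i j => ?_⟩
  · have := supNorm_le_supNorm_add_single t i; omega
  · have h1 := supNorm_le_supNorm_add_single t i
    have h2 := supNorm_le_supNorm_add_single (t + Pi.single i 1) j
    omega

/-- [folklore] **THE TRUNCATED ENGINE AT A FAR POINT** (`‖z‖∞ ≥ 8`, near radius `ρ := ⌊‖z‖∞/4⌋`, any far exponent `k`).  For a two-point weight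
`|c(x,y)| ≤ C·e^{−δ(|x|₁+|y|₁)}`, a globally bounded kernel `|H| ≤ Ag` with OUTER data — `|H t| ≤ a₀` whenever `‖z‖∞ ≤ 2‖t‖∞`, `|Δ_iH z| ≤ a₁`, second
differences `≤ b` on the box of radius `ρ` around `z` —:
`|Σ' c·H(z+x−y) − (Σ'c)·H z − Σ_i m_i·Δ_iH z| ≤ C·(4·5·b·Θ₂ + (2a₀·Θ_k + a₁·Θ_{k+1})/ρ^k) + Ag·C·e^{−(δ/2)·(‖z‖∞−1)/2}·Zl(δ/2)²`
(`ExpLocalisedBubble.abs_smear_sub_order1_le` for the outer truncation + §1 for the inner complement). -/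
theorem abs_smear_sub_order1_le_far (hδ : 0 < δ)
    (hc : ∀ p : Pt × Pt, |c p| ≤ C * (Real.exp (-δ * l1 p.1) * Real.exp (-δ * l1 p.2)))
    (hg : ∀ t, |H t| ≤ Ag) {z : Pt} (hz : 8 ≤ supNorm z) {a₀ a₁ b : ℝ} (hb : 0 ≤ b) (ha1 : 0 ≤ a₁) (k : ℕ)
    (hout0 : ∀ t : Pt, supNorm z ≤ 2 * supNorm t → |H t| ≤ a₀)
    (hout1 : ∀ i, |Δ_[(Pi.single i 1 : Pt)] H z| ≤ a₁)
    (hout2 : ∀ t : Pt, (∀ i, |t i - z i| ≤ ((supNorm z / 4 : ℕ) : ℤ)) →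
      ∀ i j, |Δ_[(Pi.single i 1 : Pt)] (Δ_[(Pi.single j 1 : Pt)] H) t| ≤ b) :
    |∑' p : Pt × Pt, c p * H (z + p.1 - p.2) - (∑' p : Pt × Pt, c p) * H z
        - ∑ i, (∑' p : Pt × Pt, c p * ((p.1 - p.2) i : ℝ)) * Δ_[(Pi.single i 1 : Pt)] H z|
      ≤ C * ((4 : ℝ) * ((4 : ℝ) + 1) * b * (2 ^ (2 + 1) * (((2 : ℕ).factorial : ℝ) * Real.exp (δ / 2) * (2 / δ) ^ 2) * Real.exp (δ / 2) * Zl 4 (δ / 2) ^ 2)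
          + (2 * a₀ * (2 ^ (k + 1) * ((k.factorial : ℝ) * Real.exp (δ / 2) * (2 / δ) ^ k) * Real.exp (δ / 2) * Zl 4 (δ / 2) ^ 2)
              + a₁ * (2 ^ (k + 1 + 1) * (((k + 1).factorial : ℝ) * Real.exp (δ / 2) * (2 / δ) ^ (k + 1)) * Real.exp (δ / 2) * Zl 4 (δ / 2) ^ 2))
            / (((supNorm z / 4 : ℕ) : ℕ) : ℝ) ^ k)
        + Ag * C * Real.exp (-(δ / 2) * (((supNorm z : ℝ) - 1) / 2)) * Zl 4 (δ / 2) ^ 2 := by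
  set Ho : Pt → ℝ := fun t => if supNorm z ≤ 2 * supNorm t then H t else 0 with hHo
  have hA : ∀ t, |Ho t| ≤ a₀ := abs_outer_le hout0
  have hρ : 0 < supNorm z / 4 := by omega
  -- first differences at `z` and second differences on the box agree with those of `H`
  have hz2 : ∀ i, supNorm z ≤ 2 * supNorm (z + Pi.single i 1) := fun i => by
    have := supNorm_le_supNorm_add_single z i; omega
  have hzz : supNorm z ≤ 2 * supNorm z := by omega
  have hA1 : ∀ i, |Δ_[(Pi.single i 1 : Pt)] Ho z| ≤ a₁ := fun i => by
    have e : Δ_[(Pi.single i 1 : Pt)] Ho z = Δ_[(Pi.single i 1 : Pt)] H z := by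
      simp only [fwdDiff, hHo, if_pos (hz2 i), if_pos hzz]
    rw [e]; exact hout1 i
  have hF2 : ∀ t : Pt, (∀ i, |t i - z i| ≤ ((supNorm z / 4 : ℕ) : ℤ)) →
      ∀ i j, |Δ_[(Pi.single i 1 : Pt)] (Δ_[(Pi.single j 1 : Pt)] Ho) t| ≤ b := by
    intro t ht i j
    obtain ⟨h0, h1, h2⟩ := outer_of_mem_box hz ht
    have e : Δ_[(Pi.single i 1 : Pt)] (Δ_[(Pi.single j 1 : Pt)] Ho) t = Δ_[(Pi.single i 1 : Pt)] (Δ_[(Pi.single j 1 : Pt)] H) t := by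
      simp only [fwdDiff, hHo, if_pos h0, if_pos (h1 i), if_pos (h1 j), if_pos (h2 i j)]
    rw [e]; exact hout2 t ht i j
  have hmain := abs_smear_sub_order1_le (D := 4) hδ hc hA (z := z) hρ hb ha1 k hA1 hF2
  -- the complement
  have hG : ∀ t, |H t - Ho t| ≤ Ag := fun t => by
    by_cases h : supNorm z ≤ 2 * supNorm t
    · simp only [hHo, if_pos h, sub_self, abs_zero]; exact (abs_nonneg _).trans (hg t)
    · simp only [hHo, if_neg h, sub_zero]; exact hg t
  have hcomp := abs_smear_le_of_vanish_near (G := fun t => H t - Ho t) hδ hc hG z (R := ((supNorm z : ℝ) - 1) / 2)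
    (fun s hs => inner_vanish (H := H) s hs)
  -- split the smeared sum
  have hsH := summable_smear hδ hc hg z
  have hsO := summable_smear hδ hc hA z
  have hsplit : ∑' p : Pt × Pt, c p * H (z + p.1 - p.2)
      = ∑' p : Pt × Pt, c p * Ho (z + p.1 - p.2) + ∑' p : Pt × Pt, c p * (H (z + p.1 - p.2) - Ho (z + p.1 - p.2)) := by
    rw [← hsO.tsum_add (hsH.sub hsO |>.congr fun p => by ring)]
    exact tsum_congr fun p => by ring
  have eHz : Ho z = H z := if_pos hzz
  have eΔ : ∀ i, Δ_[(Pi.single i 1 : Pt)] Ho z = Δ_[(Pi.single i 1 : Pt)] H z := fun i => by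
    simp only [fwdDiff, hHo, if_pos (hz2 i), if_pos hzz]
  rw [hsplit]
  simp only [eHz, eΔ] at hmain
  calc |∑' p : Pt × Pt, c p * Ho (z + p.1 - p.2) + ∑' p : Pt × Pt, c p * (H (z + p.1 - p.2) - Ho (z + p.1 - p.2))
        - (∑' p : Pt × Pt, c p) * H z - ∑ i, (∑' p : Pt × Pt, c p * ((p.1 - p.2) i : ℝ)) * Δ_[(Pi.single i 1 : Pt)] H z|
      = |(∑' p : Pt × Pt, c p * Ho (z + p.1 - p.2) - (∑' p : Pt × Pt, c p) * H z
          - ∑ i, (∑' p : Pt × Pt, c p * ((p.1 - p.2) i : ℝ)) * Δ_[(Pi.single i 1 : Pt)] H z)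
          + ∑' p : Pt × Pt, c p * (H (z + p.1 - p.2) - Ho (z + p.1 - p.2))| := by ring_nf
    _ ≤ _ := (abs_add_le _ _).trans (add_le_add hmain hcomp)

end Far

end Summit.QuantumFields.BalabanUV.Beta.FP.FarRegionSmear

end
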